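import Summits.ResolutionOfSingularities.ResolutionOfSingularities.Theorems.ValuativeLuAlphaPTorsorKnownRanges
import Literature.AlgebraicGeometry.Resolution.LocalUniformizationAbhyankarPlaces
import Mathlib.Algebra.Polynomial.AlgebraMap
import HarnessLib

/-!
# `LuAlphaPTorsor` along Abhyankar places over imperfect ground fields, modulo Cutkosky 2022

Crux `Valuative.LuAlphaPTorsor` (item `stmt-ResolutionOfSingularities-0641`), line
`pfaff-line-log-final-forms`, open stub F⁵ᵃ `stub_abhyankarInseparableCore` of the registered
skeleton (reshape v5.2): the crux along a zero-dimensional ABHYANKAR place at a closed-point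
centre of dimension `≥ 3` over an IMPERFECT ground field `k`, when neither the residue field
extension of `K` nor that of the base `K₀ = Frac A₀` over `k` is separably generated.

All separable / perfect cases are landed unconditionally (`stub_abhyankarPlace` = Knaf–Kuhlmann
2005 on `K`; `stub_abhyankarResidueExit` / `stub_abhyankarSepOfNotResidue` = Knaf–Kuhlmann 2005
on `K₀` plus the residue exit; `luAlphaPTorsor_of_isAbhyankarPlace_of_perfectField`). What is
left is exactly the content of

* S. D. Cutkosky, *Local uniformization of Abhyankar valuations*, Michigan Math. J. 71 (2022)
  677–707 = arXiv:2003.06374, Thm. 1.3: "Suppose that `K` is an algebraic function field over a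
  field `k` and `ν` is an Abhyankar valuation of `K`. Suppose that `S` is an algebraic local ring
  of `K` which is dominated by `ν`. Then there exists a birational extension `S → R` such that `R`
  is a regular algebraic local ring of `K` which is dominated by `ν` [with very good parameters]."

which removes the separability hypothesis of Knaf–Kuhlmann 2005, Thm. 1.1 (the model is then
regular, not smooth over `k`). That theorem is the tree's NAMED FACT `Literature.AlgebraicGeometry.Resolution.Cutkosky2022_Thm13`
(affine-model vocabulary of `relLU_at_abhyankarPlace`; not proved in the tree: Cutkosky's proof is a
Zariski–Perron reduction algorithm in completions with pseudo-valuations, §§3–5 of the paper).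
This file derives from it, CONDITIONALLY, the crux along every Abhyankar place
(`luAlphaPTorsor_of_isAbhyankarPlace_of_cutkosky2022`) and in particular the registered stub
F⁵ᵃ (`stub_abhyankarInseparableCore_of_cutkosky2022`). So F⁵ᵃ is `blocked-on` the fact
`Cutkosky2022_Thm13`; the non-Abhyankar core F⁵ᵇ is untouched.
-/

set_option linter.dupNamespace false

namespace Summit.ResolutionOfSingularities.ResolutionOfSingularities.Theorems.PfaffLine

open IsLocalRing Literature.AlgebraicGeometry.Resolution

/-- **The crux along every ABHYANKAR place, over every ground field, conditionally on
Cutkosky 2022, Thm. 1.3**: apply the fact to the finitely generated model `A₀[t] ⊆ O` of the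
finitely generated extension `K = Frac (A₀[t])` of `k` (no use of the torsor shape or of the
regularity of the base). Unconditional twins: `stub_abhyankarPlace` (separably generated residue
field of `K`), `luAlphaPTorsor_of_isAbhyankarPlace_of_perfectField` (perfect `k`).
[cite: Cutkosky2022, Thm. 1.3] -/
theorem luAlphaPTorsor_of_isAbhyankarPlace_of_cutkosky2022 (hC : Literature.AlgebraicGeometry.Resolution.Cutkosky2022_Thm13.{0}) :
    ∀ p : ℕ, p.Prime → ∀ (k K : Type) [Field k] [CharP k p] [Field K] [Algebra k K] (O : ValuationSubring K) (A₀ : Subalgebra k K) (h₀ : A₀.toSubring ≤ O.toSubring) (t : K), A₀.FG → t ^ p ∈ A₀ → IsFractionRing (Algebra.adjoin k (insert t (A₀ : Set K))) K → Literature.AlgebraicGeometry.Resolution.IsAbhyankarPlace O (algebraMap k K).fieldRange ⊤ → ∃ (A : Subalgebra k K) (h : A.toSubring ≤ O.toSubring), A₀ ≤ A ∧ t ∈ A ∧ A.FG ∧ IsFractionRing A K ∧ IsRegularLocalRing (Localization.AtPrime (Ideal.comap (Subring.inclusion h) (IsLocalRing.maximalIdeal O))) := by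
  intro p hp k K _ _ _ _ O A₀ h₀ t hfg htp hfr hAbh
  have htO : t ∈ O := mem_valuationSubring_of_pow_mem O hp.ne_zero (h₀ htp)
  have hRO : (Algebra.adjoin k (insert t (A₀ : Set K))).toSubring ≤ O.toSubring :=
    adjoin_insert_toSubring_le O.toSubring A₀ h₀ htO
  have hRfg : (Algebra.adjoin k (insert t (A₀ : Set K))).FG := fg_adjoin_insert hfg t
  haveI : IsFractionRing (Algebra.adjoin k (insert t (A₀ : Set K))) K := hfr
  have hKfg : (⊤ : IntermediateField k K).FG :=
    intermediateField_top_fg_of_isFractionRing (Algebra.adjoin k (insert t (A₀ : Set K))) hRfg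
  obtain ⟨A, h, hRA, hAfg, hfrA, hreg⟩ :=
    hC k K hKfg O (fun c => h₀ (A₀.algebraMap_mem c)) hAbh
      (Algebra.adjoin k (insert t (A₀ : Set K))) hRfg hRO
  exact ⟨A, h, (le_adjoin_insert A₀ t).trans hRA, hRA (mem_adjoin_insert A₀ t), hAfg, hfrA,
    hreg⟩

set_option linter.unusedVariables false in
/-- **The registered open stub F⁵ᵃ `stub_abhyankarInseparableCore` of the line
`pfaff-line-log-final-forms`, conditionally on Cutkosky 2022, Thm. 1.3** (exact registered
signature behind the named-fact hypothesis): the zero-dimensionality, the closed centre, the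
dimension bound, the inseparability / imperfectness clauses, the non-discreteness and the
derivative / `p`-th-power clauses are all idle — the Abhyankar hypothesis alone suffices given
the fact. So F⁵ᵃ is `blocked-on` `Cutkosky2022_Thm13` and nothing else.
[cite: Cutkosky2022, Thm. 1.3] -/
theorem stub_abhyankarInseparableCore_of_cutkosky2022 :
    Literature.AlgebraicGeometry.Resolution.Cutkosky2022_Thm13.{0} → ∀ p : ℕ, p.Prime → ∀ (k K : Type) [Field k] [CharP k p] [Field K] [Algebra k K] (O : ValuationSubring K) (A₀ : Subalgebra k K) (h₀ : A₀.toSubring ≤ O.toSubring) (t : K), A₀.FG → ∀ (htp : t ^ p ∈ A₀), IsFractionRing (Algebra.adjoin k (insert t (A₀ : Set K))) K → IsRegularLocalRing (Localization.AtPrime (Ideal.comap (Subring.inclusion h₀) (IsLocalRing.maximalIdeal O))) → (Ideal.comap (Subring.inclusion h₀) (IsLocalRing.maximalIdeal O)).IsMaximal → (∀ x : K, x ∈ O → ∃ f : Polynomial k, f ≠ 0 ∧ Polynomial.aeval x f ∈ O.nonunits) → ¬ ringKrullDim (Localization.AtPrime (Ideal.comap (Subring.inclusion h₀) (IsLocalRing.maximalIdeal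 O))) ≤ 2 → Literature.AlgebraicGeometry.Resolution.IsAbhyankarPlace O (algebraMap k K).fieldRange ⊤ → ¬ Literature.AlgebraicGeometry.Resolution.SeparablyGeneratedOver (Literature.AlgebraicGeometry.Resolution.resField O (algebraMap k K).fieldRange) (Literature.AlgebraicGeometry.Resolution.resField O ⊤) → ¬ Literature.AlgebraicGeometry.Resolution.SeparablyGeneratedOver (Literature.AlgebraicGeometry.Resolution.resField O (algebraMap k K).fieldRange) (Literature.AlgebraicGeometry.Resolution.resField O (Subfield.closure (A₀ : Set K))) → ¬ PerfectField k → ¬ (∃ π : K, π ≠ 0 ∧ O.valuation π < 1 ∧ ∀ z : K, z ≠ 0 → ∃ n : ℤ, O.valuation z = O.valuation π ^ n) → (∀ δ : Derivation ℤ (Localization.AtPrime (Ideal.comap (Subring.inclusion h₀) (IsLocalRing.maximalIdeal O))) (Localization.AtPrime (Ideal.comap (Subring.inclusion h₀) (IsLocalRing.maximalIdeal O))), ¬ IsUnit (δ (algebraMap A₀.toSubring (Localization.AtPrime (Ideal.comap (Subring.inclusion h₀) (IsLocalRing.maximalIdeal O))) ⟨t ^ p, htp⟩))) → (∀ c : Localization.AtPrime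 (Ideal.comap (Subring.inclusion h₀) (IsLocalRing.maximalIdeal O)), algebraMap A₀.toSubring (Localization.AtPrime (Ideal.comap (Subring.inclusion h₀) (IsLocalRing.maximalIdeal O))) ⟨t ^ p, htp⟩ ≠ c ^ p) → ∃ (A : Subalgebra k K) (h : A.toSubring ≤ O.toSubring), A₀ ≤ A ∧ t ∈ A ∧ A.FG ∧ IsFractionRing A K ∧ IsRegularLocalRing (Localization.AtPrime (Ideal.comap (Subring.inclusion h) (IsLocalRing.maximalIdeal O))) := by
  intro hC p hp k K _ _ _ _ O A₀ h₀ t hfg htp hfr _ _ _ _ hAbh _ _ _ _ _ _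
  exact luAlphaPTorsor_of_isAbhyankarPlace_of_cutkosky2022 hC p hp k K O A₀ h₀ t hfg htp hfr hAbh

end Summit.ResolutionOfSingularities.ResolutionOfSingularities.Theorems.PfaffLine
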